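import Summits.AtomisticToContinuum.Crystallization.Theorems.PalmUnimodularRigidityShellsToBarlowChartTransportOpsDefs

/-!
# Line `develop-the-model-growth-descent` (crux `ShellsToBarlowChart`, stmt-AtomisticToContinuum-9227): pattern facts, part 5

Decidable facts about the two integer kissing patterns `fcc3Int`, `hcpInt` (labels at squared
norm `18`) used by the frame transports of `stub_transportSystem`: hexagons, even/odd caps,
their filters, apexes, distance tables, lower caps and the letters read on them.  Every fact was
first verified by brute force (work/sim/facts.py of the lead's folder) and is proved here by
`decide` (split into small files so that each elaborates quickly).  All `[folklore]`
(finite checks on the cuboctahedron / anticuboctahedron, HalesDSP2012 §1.3).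
-/

namespace Summit.AtomisticToContinuum.Crystallization.Theorems.PalmUnimodularRigidityShellsToBarlowChart

open Literature.Geometry.DiscreteGeometry

/-- HCP: the touching neighbour `v` of an equatorial label `w` at `D = 54` from another equatorial neighbour `κ` of `w` is equatorial. [folklore] -/
theorem neg_mem_of_chain : ∀ w ∈ hcpInt, ∀ κ ∈ hcpInt, ∀ v ∈ hcpInt, -w ∈ hcpInt → -κ ∈ hcpInt → sqNormInt (w - v) = 18 → sqNormInt (w - κ) = 18 → sqNormInt (v - κ) = 54 → -v ∈ hcpInt := by
  decide

/-- Lower references of the four in-layer transports (oddCap): the unique lower-cap element touching `a` (resp. `b`, `−a`, `−b`), never equal or adjacent to the upper-cap element touching the same label. [folklore] -/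
theorem lowerRef_oddCap : ∀ P : Finset (Fin 3 → ℤ), (P = fcc3Int ∨ P = hcpInt) →
    ∀ a ∈ P, ∀ b ∈ P, ∀ c ∈ P, sqNormInt (a - b) = 18 → hexLabels a b ⊆ P → c ∉ hexLabels a b → c + a ∈ P → c + b ∈ P → (∃ ℓ ∈ lowerCap P a b ({c, c + a, c + b} : Finset (Fin 3 → ℤ)), sqNormInt (ℓ - a) = 18 ∧ (lowerCap P a b ({c, c + a, c + b} : Finset (Fin 3 → ℤ))).filter (fun e => sqNormInt (e - a) = 18) = {ℓ} ∧ ∀ e ∈ ({c, c + a, c + b} : Finset (Fin 3 → ℤ)), sqNormInt (e - a) = 18 → (sqNormInt (ℓ - e) ≠ 0 ∧ sqNormInt (ℓ - e) ≠ 18)) ∧ (∃ ℓ ∈ lowerCap P a b ({c, c + a, c + b} : Finset (Fin 3 → ℤ)), sqNormInt (ℓ - b) = 18 ∧ (lowerCap P a b ({c, c + a, c + b} : Finset (Fin 3 → ℤ))).filter (fun e => sqNormInt (e - b) = 18) = {ℓ} ∧ ∀ e ∈ ({c, c + a, c + b} : Finset (Fin 3 → ℤ)), sqNormInt (e - b)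 = 18 → (sqNormInt (ℓ - e) ≠ 0 ∧ sqNormInt (ℓ - e) ≠ 18)) ∧ (∃ ℓ ∈ lowerCap P a b ({c, c + a, c + b} : Finset (Fin 3 → ℤ)), sqNormInt (ℓ + a) = 18 ∧ (lowerCap P a b ({c, c + a, c + b} : Finset (Fin 3 → ℤ))).filter (fun e => sqNormInt (e + a) = 18) = {ℓ} ∧ ∀ e ∈ ({c, c + a, c + b} : Finset (Fin 3 → ℤ)), sqNormInt (e + a) = 18 → (sqNormInt (ℓ - e) ≠ 0 ∧ sqNormInt (ℓ - e) ≠ 18)) ∧ (∃ ℓ ∈ lowerCap P a b ({c, c + a, c + b} : Finset (Fin 3 → ℤ)), sqNormInt (ℓ + b) = 18 ∧ (lowerCap P a b ({c, c + a, c + b} : Finset (Fin 3 → ℤ))).filter (fun e => sqNormInt (e + b) = 18) = {ℓ} ∧ ∀ e ∈ ({c, c + a, c + b} : Finset (Fin 3 → ℤ)), sqNormInt (e + b) = 18 → (sqNormInt (ℓ - e) ≠ 0 ∧ sqNormInt (ℓ - e) ≠ 18)) := by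
  rintro P (rfl | rfl) <;> decide

/-- The cap opposite to any lower-cap label is the upper cap. [folklore] -/
theorem capOpp_of_mem_lowerCap_oddCap : ∀ P : Finset (Fin 3 → ℤ), (P = fcc3Int ∨ P = hcpInt) →
    ∀ a ∈ P, ∀ b ∈ P, ∀ c ∈ P, ∀ e ∈ P, sqNormInt (a - b) = 18 → hexLabels a b ⊆ P → c ∉ hexLabels a b → c + a ∈ P → c + b ∈ P → e ∈ lowerCap P a b ({c, c + a, c + b} : Finset (Fin 3 → ℤ)) → capOpp P a b e = ({c, c + a, c + b} : Finset (Fin 3 → ℤ)) := by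
  rintro P (rfl | rfl) <;> decide

/-- Upper-cap and lower-cap labels are never equal or adjacent. [folklore] -/
theorem cross_cap_oddCap : ∀ P : Finset (Fin 3 → ℤ), (P = fcc3Int ∨ P = hcpInt) →
    ∀ a ∈ P, ∀ b ∈ P, ∀ c ∈ P, ∀ l ∈ P, sqNormInt (a - b) = 18 → hexLabels a b ⊆ P → c ∉ hexLabels a b → c + a ∈ P → c + b ∈ P → l ∈ lowerCap P a b ({c, c + a, c + b} : Finset (Fin 3 → ℤ)) → (sqNormInt (c - l) ≠ 0 ∧ sqNormInt (c - l) ≠ 18) ∧ (sqNormInt (c + a - l) ≠ 0 ∧ sqNormInt (c + a - l) ≠ 18) ∧ (sqNormInt (c + b - l) ≠ 0 ∧ sqNormInt (c + b - l) ≠ 18) := by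
  rintro P (rfl | rfl) <;> decide

/-- V⁻¹-step (letter below `+1`): for three mutually touching one-sided labels `ξ, η, ζ` (the upper sites `x, I⁻¹x, J⁻¹x` seen from `d`) the directions `ξ − η, ξ − ζ` with the cap of `ξ` form a valid frame of parity `+1` whose upper cap is `{ξ, η, ζ}`. [folklore] -/
theorem isFrame_capWith_even : ∀ P : Finset (Fin 3 → ℤ), (P = fcc3Int ∨ P = hcpInt) →
    ∀ ξ ∈ P, ∀ η ∈ P, ∀ ζ ∈ P, sqNormInt (ξ - η) = 18 → sqNormInt (ξ - ζ) = 18 → sqNormInt (η - ζ) = 18 → ((-ξ ∈ P ∧ -η ∈ P ∧ -ζ ∈ P) ∨ (-ξ ∉ P ∧ -η ∉ P ∧ -ζ ∉ P)) → IsFrame P (ξ - η) (ξ - ζ) (capWith P (ξ - η) (ξ - ζ) ξ) ∧ capWith P (ξ - η) (ξ - ζ) ξ = ({ξ, η, ζ} : Finset (Fin 3 → ℤ)) ∧ frameParity (ξ - η) (ξ - ζ) (capWith P (ξ - η) (ξ - ζ) ξ) = 1 := by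
  rintro P (rfl | rfl) <;> decide

/-- V⁻¹-step (letter below `−1`): for three mutually touching one-sided labels `ξ, η, ζ` (the upper sites `x, Ix, Jx` seen from `d`) the directions `η − ξ, ζ − ξ` with the cap of `ξ` form a valid frame of parity `−1` whose upper cap is `{ξ, η, ζ}`. [folklore] -/
theorem isFrame_capWith_odd : ∀ P : Finset (Fin 3 → ℤ), (P = fcc3Int ∨ P = hcpInt) →
    ∀ ξ ∈ P, ∀ η ∈ P, ∀ ζ ∈ P, sqNormInt (ξ - η) = 18 → sqNormInt (ξ - ζ) = 18 → sqNormInt (η - ζ) = 18 → ((-ξ ∈ P ∧ -η ∈ P ∧ -ζ ∈ P) ∨ (-ξ ∉ P ∧ -η ∉ P ∧ -ζ ∉ P)) → IsFrame P (η - ξ) (ζ - ξ) (capWith P (η - ξ) (ζ - ξ) ξ) ∧ capWith P (η - ξ) (ζ - ξ) ξ = ({ξ, η, ζ} : Finset (Fin 3 → ℤ)) ∧ frameParity (η - ξ) (ζ - ξ) (capWith P (η - ξ) (ζ - ξ) ξ) = -1 := by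
  rintro P (rfl | rfl) <;> decide

/-- I-step: the hexagon labels at the new site touching the label `w` of the old site are `v` and `w − v`. [folklore] -/
theorem hex_touching_w_I : ∀ P : Finset (Fin 3 → ℤ), (P = fcc3Int ∨ P = hcpInt) →
    ∀ w ∈ P, ∀ v ∈ P, -w ∈ P → -v ∈ P → sqNormInt (w - v) = 18 → ∀ h ∈ hexLabels (-w) (v - w), sqNormInt (h - w) = 18 → (h = v ∨ h = w - v) := by
  rintro P (rfl | rfl) <;> decide

/-- J-step: the hexagon labels at the new site touching the label `w` of the old site are `v` and `w − v`. [folklore] -/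
theorem hex_touching_w_J : ∀ P : Finset (Fin 3 → ℤ), (P = fcc3Int ∨ P = hcpInt) →
    ∀ w ∈ P, ∀ v ∈ P, -w ∈ P → -v ∈ P → sqNormInt (w - v) = 18 → ∀ h ∈ hexLabels (v - w) (-w), sqNormInt (h - w) = 18 → (h = v ∨ h = w - v) := by
  rintro P (rfl | rfl) <;> decide

/-- Iinv-step: the hexagon labels at the new site touching the label `w` of the old site are `v` and `w − v`. [folklore] -/
theorem hex_touching_w_Iinv : ∀ P : Finset (Fin 3 → ℤ), (P = fcc3Int ∨ P = hcpInt) →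
    ∀ w ∈ P, ∀ v ∈ P, -w ∈ P → -v ∈ P → sqNormInt (w - v) = 18 → ∀ h ∈ hexLabels w v, sqNormInt (h - w) = 18 → (h = v ∨ h = w - v) := by
  rintro P (rfl | rfl) <;> decide

/-- Jinv-step: the hexagon labels at the new site touching the label `w` of the old site are `v` and `w − v`. [folklore] -/
theorem hex_touching_w_Jinv : ∀ P : Finset (Fin 3 → ℤ), (P = fcc3Int ∨ P = hcpInt) →
    ∀ w ∈ P, ∀ v ∈ P, -w ∈ P → -v ∈ P → sqNormInt (w - v) = 18 → ∀ h ∈ hexLabels v w, sqNormInt (h - w) = 18 → (h = v ∨ h = w - v) := by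
  rintro P (rfl | rfl) <;> decide

/-- evenCap: squared distances from the cap label `c` to the six hexagon labels. [folklore] -/
theorem dist_evenCap_c : ∀ P : Finset (Fin 3 → ℤ), (P = fcc3Int ∨ P = hcpInt) →
    ∀ a ∈ P, ∀ b ∈ P, ∀ c ∈ P, sqNormInt (a - b) = 18 → hexLabels a b ⊆ P → c ∉ hexLabels a b → c - a ∈ P → c - b ∈ P → sqNormInt (c - a) = 18 ∧ sqNormInt (c - b) = 18 ∧ sqNormInt (c - (b - a)) = 36 ∧ sqNormInt (c - (-a)) = 54 ∧ sqNormInt (c - (-b)) = 54 ∧ sqNormInt (c - (a - b)) = 36 := by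
  rintro P (rfl | rfl) <;> decide

end Summit.AtomisticToContinuum.Crystallization.Theorems.PalmUnimodularRigidityShellsToBarlowChart
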